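import Literature.NumberTheory.LFunctions.SuzukiScrewLineRepairedExpansion
import Literature.NumberTheory.LFunctions.SuzukiScrewLineProp31Proofs
import HarnessLib

/-!
# The repaired screw line: CJM Lemma 3.2ᴿ DISCHARGED, (3.7)ᴿ unconditional, and the glue Cor 1.5ᴿ ⟺ Thm 1.4ᴿ

LINE 1 — LABEL: RH-FREE proofs (theorems only; no definition, no named fact; net debt −1: the named
fact `Suzuki2025_lemma32R` is DISCHARGED). bears_on: B-C/B-P (LADDER-RH COLUMN 6 DBR). WHAT THIS
IS NOT: `Suzuki2025_lemma32R` (CJM Lemma 3.2 over the repaired screw line, erratum E21) is an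
RH-FREE structural statement (‖·‖₀ᴿ is a norm on `C_c^∞(ℝ)`); the criteria `Suzuki2025_thm44R` /
`thm14R` / `cor15R` stay RH-EQUIVALENT·PRINTED and unproved — below they are only glued to each
other and given their RH-free halves; nothing here bears on the truth of RH.

Source: M. Suzuki, Canad. J. Math. 2025 = arXiv:2301.00421v3: Lemma 3.2 (TeX l.1073–1093) with
Prop 3.1 (TeX l.789–793, discharged by the cell as `Suzuki2025_prop31_holds`), (3.7) (TeX
l.1040–1049); Cor 1.5 (TeX l.438–451) and its proof §4.3 (TeX l.1352–1380). Read over the repaired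
objects `screwPR` / `screwPhatR` / `screwNormZeroR` / `IsVcircRepR` / `suzukiVcircR` of
`SuzukiScrewLineRepaired.lean`; the conditional forms (hypothesis `h31 : Suzuki2025_prop31`) are in
`SuzukiScrewLineRepairedExpansion.lean`.

## What is proved
* `Suzuki2025_lemma32R_holds : Suzuki2025_lemma32R` — **CJM Lemma 3.2 for the repaired seminorm,
  unconditionally** (`Suzuki2025_lemma32R_of_prop31 Suzuki2025_prop31_holds`); with the unconditional
  forms `Suzuki2025_lemma32R_iii` ((iii): `‖ψ‖₀ᴿ = 0 ⇒ ψ = 0`), `screwNormZeroR_eq_zero_iff` (`‖·‖₀ᴿ` is a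
  norm on `C_c^∞(ℝ)`), `screwPhatR_eq_tsum` ((3.7)ᴿ on the real line), `screwPhatR_eq_tsum_suzukiHat`
  (the same in the printed variables `φ̂(γ) − φ̂(0)`, after `ρ ↦ 1 − ρ̄`) and
  `screwPR_eq_screwZeroExpansionR` (`𝔓ᴿ_t = P_t` for all real `t`).
* `norm_sq_of_isVcircRepR` — Plancherel on `V°(0)ᴿ`: `𝖥ψ = P̂ᴿ_{Dψ₀}` ⟹ `‖ψ‖² = (2π)⁻¹‖P̂ᴿ_{Dψ₀}‖²`;
  `exists_mem_suzukiVcircR` — every test function generates an element of `V°(0)ᴿ` (Prop 1.3ᴿ is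
  the theorem `memLp_screwPhatR`, so this is unconditional); `zero_mem_suzukiVcircR`.
* `Suzuki2025_eq110R_iff_eq19R` — "(1.9) is reformulated to the simpler form (1.10)", repaired;
  `Suzuki2025_cor15R_of_thm14R`, `Suzuki2025_thm14R_of_cor15R`, `Suzuki2025_cor15R_iff_thm14R`,
  `Suzuki2025_cor15R_of_thm44R` — the repaired records Cor 1.5ᴿ / Thm 1.4ᴿ are one statement in the
  kernel and follow from Thm 4.4ᴿ; `Suzuki2025_cor15R_if` — the RH-free half "(1.10)ᴿ ⟹ RH" (Weil's
  criterion); `Suzuki2025_cor15R_of_onlyIf` — Cor 1.5ᴿ reduces to "RH ⟹ (1.10)ᴿ".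
* `sq_screwNormZeroR_eq_of_isVcircRepR` — `(‖ψ₀‖₀ᴿ)² = 2‖𝖥⁻¹P̂ᴿ_{Dψ₀}‖²`; `IsVcircRepR.generator_unique` —
  the generating test function of an element of `V°(0)ᴿ` is UNIQUE (Lemma 3.2ᴿ (iii)); hence
  `weilQuadratic_generator_wellDefined` — "`⟨ψ,ψ⟩_W` is defined" on `V°(0)ᴿ` (this is exactly what
  fails for the printed even extension, erratum E21).

## References
* [Suzuki2025WeilHilbertSpace] CJM 2025 = arXiv:2301.00421v3, Lemma 3.2 (TeX l.1073–1093), Prop 3.1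
  (TeX l.789–793), (3.7) (TeX l.1040–1049), Cor 1.5 (TeX l.438–451), §4.3 (TeX l.1352–1380), (5.8)
  (TeX l.1697).
* [Suzuki2023] M. Suzuki, J. London Math. Soc. 2023, Lemma 2.1 (tree `Suzuki2023_lemma21_holds`).
-/

noncomputable section

open MeasureTheory Complex Filter Set Real
open scoped ComplexConjugate Topology FourierTransform ENNReal InnerProductSpace

namespace Literature.NumberTheory.LFunctions

open ScrewLineRepairedExpansion

/-! ## A. CJM Lemma 3.2ᴿ discharged and the unconditional (3.7)ᴿ / `𝔓ᴿ_t = P_t` -/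

/-- **CJM Lemma 3.2 for the repaired seminorm — DISCHARGED (RH-free):** `‖·‖₀ᴿ` is subadditive and
absolutely homogeneous on `C_c^∞(ℝ)` and `‖ψ‖₀ᴿ = 0 ⇒ ψ = 0`. (i)(ii) are elementary
(`Suzuki2025_lemma32R_subadd/absHom`); (iii) is the printed argument ((3.7) + the pole-series
residue step + [Su22, Lemma 2.1]) over the repaired objects, `Suzuki2025_lemma32R_iii_of_prop31`, fed
with the cell's discharge `Suzuki2025_prop31_holds` of CJM Prop 3.1.
[cite: Suzuki2025WeilHilbertSpace, Lemma 3.2 (TeX l.1073–1093); erratum E21] -/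
theorem Suzuki2025_lemma32R_holds : Suzuki2025_lemma32R :=
  Suzuki2025_lemma32R_of_prop31 Suzuki2025_prop31_holds

/-- **CJM Lemma 3.2 (iii), repaired, unconditional**: `‖ψ‖₀ᴿ = 0 ⇒ ψ = 0` for `ψ ∈ C_c^∞(ℝ)`.
[cite: Suzuki2025WeilHilbertSpace, Lemma 3.2 (iii) (TeX l.1076–1077, proof l.1085–1093); erratum E21] -/
theorem Suzuki2025_lemma32R_iii :
    ∀ ψ : ℝ → ℂ, IsWeilTest ψ → screwNormZeroR ψ = 0 → ψ = 0 :=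
  Suzuki2025_lemma32R_iii_of_prop31 Suzuki2025_prop31_holds

/-- **`‖·‖₀ᴿ` is a NORM on `C_c^∞(ℝ)`: `‖ψ‖₀ᴿ = 0 ↔ ψ = 0`** (Lemma 3.2ᴿ (iii) and `P̂ᴿ_{D0} = 0`).
[cite: Suzuki2025WeilHilbertSpace, Lemma 3.2 (TeX l.1073–1077: "(3.9) defines a norm on C_c^∞(ℝ)"); erratum E21] -/
theorem screwNormZeroR_eq_zero_iff {ψ : ℝ → ℂ} (hψ : IsWeilTest ψ) :
    screwNormZeroR ψ = 0 ↔ ψ = 0 := by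
  refine ⟨Suzuki2025_lemma32R_iii ψ hψ, fun h ↦ ?_⟩
  subst h
  have hD : suzukiD (0 : ℝ → ℂ) = 0 := by
    funext t; simp [suzukiD]
  have hP : ∀ x : ℝ, screwPhatR (0 : ℝ → ℂ) x = 0 := fun x ↦ by simp [screwPhatR]
  simp [screwNormZeroR, hD, hP]

/-- **(3.7)ᴿ on the real line, unconditional**: for a test function `φ` and a real `x ≠ 0` with
`E_ξ(x) ≠ 0`, `±x ∉ Γ`: `P̂ᴿ_φ(x) = −(i/2)(1 + Θ(x)) Σ_ρ m_ρ c_ρ(φ)/(γ̄_ρ (x − γ̄_ρ))`,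
`c_ρ(φ) = ∫_ℝ (e^{iγ̄_ρt} − 1)φ(t)dt`. [cite: Suzuki2025WeilHilbertSpace, (3.7) (TeX l.1040–1049) with Prop. 3.1; erratum E21] -/
theorem screwPhatR_eq_tsum {φ : ℝ → ℂ} (hφ : IsWeilTest φ) {x : ℝ} (hx0 : x ≠ 0)
    (hE : lagariasE x ≠ 0)
    (hxΓ : ∀ ρ ∈ ZetaZeros.riemannZetaNontrivialZeros, (x : ℂ) ≠ suzukiZeroParam ρ)
    (hxΓ' : ∀ ρ ∈ ZetaZeros.riemannZetaNontrivialZeros, -(x : ℂ) ≠ suzukiZeroParam ρ) :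
    screwPhatR φ x = -(I / 2) * (1 + lagariasTheta x) *
      ∑' ρ : ZetaZeros.riemannZetaNontrivialZeros, (riemannZetaZeroOrder (ρ : ℂ) : ℂ) *
        (∫ t : ℝ, (cexp (I * conj (suzukiZeroParam (ρ : ℂ)) * t) - 1) * φ t) /
        (conj (suzukiZeroParam (ρ : ℂ)) * ((x : ℂ) - conj (suzukiZeroParam (ρ : ℂ)))) :=
  screwPhatR_eq_tsum_of_prop31 Suzuki2025_prop31_holds hφ hx0 hE hxΓ hxΓ'

/-- **(3.7)ᴿ in the printed variables** — the coefficients are Suzuki's transform (1.1)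
`φ̂(w) = ∫ φ(t)e^{iwt}dt` (`suzukiHat`): after the reflection `ρ ↦ 1 − ρ̄` (`γ̄ ↦ γ`, `m` invariant),
`P̂ᴿ_φ(x) = −(i/2)(1 + Θ(x)) Σ_γ m_γ (φ̂(γ) − φ̂(0))/(γ (x − γ))` for a.e.-every real `x` as above. This
is printed (3.7) `Σ_γ √(πm_γ)(φ̂(γ) − φ̂(0))/γ · F_γ(x)`, `F_γ = √(m_γ/π)· i(1+Θ)/(2(z − γ))`, up to
the global sign of `F_γ` (the print is loose by the conjugation `F_γ ↔ F_γ♯`; signs are immaterial for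
`‖·‖₀`). RH-FREE. [cite: Suzuki2025WeilHilbertSpace, (3.5)–(3.7) (TeX l.1019–1049); erratum E21] -/
theorem screwPhatR_eq_tsum_suzukiHat {φ : ℝ → ℂ} (hφ : IsWeilTest φ) {x : ℝ} (hx0 : x ≠ 0)
    (hE : lagariasE x ≠ 0)
    (hxΓ : ∀ ρ ∈ ZetaZeros.riemannZetaNontrivialZeros, (x : ℂ) ≠ suzukiZeroParam ρ)
    (hxΓ' : ∀ ρ ∈ ZetaZeros.riemannZetaNontrivialZeros, -(x : ℂ) ≠ suzukiZeroParam ρ) :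
    screwPhatR φ x = -(I / 2) * (1 + lagariasTheta x) *
      ∑' ρ : ZetaZeros.riemannZetaNontrivialZeros, (riemannZetaZeroOrder (ρ : ℂ) : ℂ) *
        (suzukiHat φ (suzukiZeroParam (ρ : ℂ)) - suzukiHat φ 0) /
        (suzukiZeroParam (ρ : ℂ) * ((x : ℂ) - suzukiZeroParam (ρ : ℂ))) := by
  rw [screwPhatR_eq_tsum hφ hx0 hE hxΓ hxΓ']
  congr 1
  -- the coefficient integral is `φ̂(γ̄) − φ̂(0)`
  have hφi : Integrable φ := hφ.1.continuous.integrable_of_hasCompactSupport hφ.2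
  have hcoef : ∀ ρ : ZetaZeros.riemannZetaNontrivialZeros,
      ∫ t : ℝ, (cexp (I * conj (suzukiZeroParam (ρ : ℂ)) * t) - 1) * φ t =
        suzukiHat φ (conj (suzukiZeroParam (ρ : ℂ))) - suzukiHat φ 0 := by
    intro ρ
    have hb : |(I * conj (suzukiZeroParam (ρ : ℂ))).re| ≤ 1 / 2 := by
      obtain ⟨-, h0', h1⟩ := mem_riemannZetaNontrivialZeros_iff_holds.1 ρ.2
      have : (I * conj (suzukiZeroParam (ρ : ℂ))).re = (ρ : ℂ).re - 1 / 2 := by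
        simp [suzukiZeroParam]
      rw [this]; exact abs_le.2 ⟨by linarith, by linarith⟩
    have h1 : Integrable fun t : ℝ ↦ (cexp (I * conj (suzukiZeroParam (ρ : ℂ)) * t) - 1) * φ t :=
      integrableOn_univ.1 (integrableOn_expCoeffIntegrand hφ hb univ)
    have h2 : Integrable fun t : ℝ ↦ φ t * cexp (I * conj (suzukiZeroParam (ρ : ℂ)) * t) :=
      (h1.add hφi).congr (ae_of_all _ fun t ↦ by simp only [Pi.add_apply]; ring)
    rw [suzukiHat, suzukiHat, ← integral_sub h2 (hφi.congr (ae_of_all _ fun t ↦ by simp))]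
    refine integral_congr_ae (ae_of_all _ fun t ↦ ?_)
    simp only [mul_zero, zero_mul, Complex.exp_zero, mul_one]
    ring
  simp_rw [hcoef]
  -- reflect `ρ ↦ 1 − ρ̄`
  have hinv : Function.Involutive (fun ρ : ZetaZeros.riemannZetaNontrivialZeros ↦
      (⟨1 - conj (ρ : ℂ), ZetaZeros.riemannZetaNontrivialZeros.one_sub_conj_mem ρ.2⟩ :
        ZetaZeros.riemannZetaNontrivialZeros)) := by
    intro ρ; ext; simp
  rw [← Equiv.tsum_eq (hinv.toPerm _)]
  refine tsum_congr fun ρ ↦ ?_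
  obtain ⟨-, h0', h1⟩ := mem_riemannZetaNontrivialZeros_iff_holds.1 ρ.2
  have hγe : suzukiZeroParam ((hinv.toPerm _ ρ : ZetaZeros.riemannZetaNontrivialZeros) : ℂ) =
      conj (suzukiZeroParam (ρ : ℂ)) := by
    simp only [Function.Involutive.coe_toPerm]
    exact suzukiZeroParam_one_sub_conj _
  have hme : (riemannZetaZeroOrder ((hinv.toPerm _ ρ : ZetaZeros.riemannZetaNontrivialZeros) : ℂ) : ℂ)
      = riemannZetaZeroOrder (ρ : ℂ) := by
    simp only [Function.Involutive.coe_toPerm]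
    exact_mod_cast riemannZetaZeroOrder_one_sub_conj h0' h1
  rw [hγe, hme, Complex.conj_conj]

/-- **`𝔓ᴿ_t = P_t` for all real `t`, unconditional** (the literal zero expansion (3.2) for negative
`t`, `screwZeroExpansionR`), off `Γ` and off the cancelling poles of `𝔓_{|t|}(±z)`.
[cite: Suzuki2025WeilHilbertSpace, Prop. 3.1 (TeX l.789–793) with (3.2); erratum E21] -/
theorem screwPR_eq_screwZeroExpansionR (t : ℝ) {z : ℂ} (hz0 : z ≠ 0) (hzI : z ≠ I / 2)
    (hzI' : z ≠ -(I / 2)) (hzn : ∀ n : ℕ, z ≠ -(I * (2 * n + 1 / 2)))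
    (hzn' : ∀ n : ℕ, z ≠ I * (2 * n + 1 / 2))
    (hzΓ : ∀ ρ ∈ ZetaZeros.riemannZetaNontrivialZeros, z ≠ suzukiZeroParam ρ) :
    screwPR t z = screwZeroExpansionR t z :=
  screwPR_eq_screwZeroExpansionR_of_prop31 Suzuki2025_prop31_holds t hz0 hzI hzI' hzn hzn' hzΓ

/-! ## B. Plancherel on `V°(0)ᴿ` and the glue Cor 1.5ᴿ ⟺ Thm 1.4ᴿ -/

namespace ScrewLineRepairedCor15

/-- `‖F‖² = ∫ ‖F(ξ)‖² dξ` for a class `F ∈ L²(ℝ)`. [folklore] -/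
private theorem norm_sq_eq_integral_norm_sq (F : Lp ℂ 2 (volume : Measure ℝ)) :
    ‖F‖ ^ 2 = ∫ ξ : ℝ, ‖(F : ℝ → ℂ) ξ‖ ^ 2 := by
  have h1 : inner ℂ F F = ((‖F‖ ^ 2 : ℝ) : ℂ) := by
    rw [inner_self_eq_norm_sq_to_K]; norm_cast
  have h2 : inner ℂ F F = ((∫ ξ : ℝ, ‖(F : ℝ → ℂ) ξ‖ ^ 2 : ℝ) : ℂ) := by
    rw [L2.inner_def, ← integral_complex_ofReal]
    refine integral_congr_ae (ae_of_all _ fun ξ ↦ ?_)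
    beta_reduce
    rw [inner_self_eq_norm_sq_to_K]
    norm_cast
  exact_mod_cast Complex.ofReal_injective (h1.symm.trans h2)

/-- `∫ g(−2πξ) dξ = (2π)⁻¹ ∫ g(u) du`. [folklore] -/
private theorem integral_comp_neg_two_pi_mul (g : ℝ → ℝ) :
    ∫ ξ : ℝ, g (-(2 * Real.pi) * ξ) = (2 * Real.pi)⁻¹ * ∫ u : ℝ, g u := by
  rw [Measure.integral_comp_mul_left g (-(2 * Real.pi)), smul_eq_mul, abs_inv, abs_neg,
    abs_of_pos Real.two_pi_pos]

/-- `L²` is stable under the dilations `ξ ↦ aξ`, `a ≠ 0`. [folklore] -/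
private theorem memLp_two_comp_mul_left {P : ℝ → ℂ} (hP : MemLp P 2 volume) {a : ℝ}
    (ha : a ≠ 0) : MemLp (fun ξ : ℝ ↦ P (a * ξ)) 2 volume :=
  (hP.smul_measure ENNReal.ofReal_ne_top).comp_measurePreserving
    ⟨measurable_const_mul a, Real.map_volume_mul_left ha⟩

end ScrewLineRepairedCor15

open ScrewLineRepairedCor15

/-- **Plancherel on `V°(0)ᴿ`**: if `𝖥ψ = P̂ᴿ_{Dψ₀}` then `‖ψ‖²_{L²(ℝ)} = (2π)⁻¹‖P̂ᴿ_{Dψ₀}‖²_{L²(ℝ)}`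
("`‖ψ̂‖² = 2π‖ψ‖²`", (5.8), read backwards through `𝓕`), over the repaired `P̂ᴿ`. RH-FREE.
[cite: Suzuki2025WeilHilbertSpace, proof of Cor. 1.5, §4.3 (TeX l.1374–1377); erratum E21] -/
theorem norm_sq_of_isVcircRepR {ψ₀ : ℝ → ℂ} {ψ : Lp ℂ 2 (volume : Measure ℝ)}
    (h : IsVcircRepR ψ₀ ψ) :
    ‖ψ‖ ^ 2 = (2 * Real.pi)⁻¹ * ∫ x : ℝ, ‖screwPhatR (suzukiD ψ₀) x‖ ^ 2 := by
  rw [← Lp.norm_fourier_eq ψ, ScrewLineRepairedCor15.norm_sq_eq_integral_norm_sq]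
  have hae : (fun ξ : ℝ ↦ ‖((𝓕 ψ : Lp ℂ 2 (volume : Measure ℝ)) : ℝ → ℂ) ξ‖ ^ 2) =ᵐ[volume]
      fun ξ : ℝ ↦ (fun x : ℝ ↦ ‖screwPhatR (suzukiD ψ₀) x‖ ^ 2) (-(2 * Real.pi) * ξ) := by
    filter_upwards [h] with ξ hξ
    rw [hξ]
  rw [integral_congr_ae hae]
  exact ScrewLineRepairedCor15.integral_comp_neg_two_pi_mul
    (fun x : ℝ ↦ ‖screwPhatR (suzukiD ψ₀) x‖ ^ 2)

/-- **Every test function generates an element of `V°(0)ᴿ`** — unconditionally, since Prop 1.3ᴿ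
(`P̂ᴿ_{Dψ₀} ∈ L²`) is the theorem `memLp_screwPhatR`: `ψ := 𝖥⁻¹P̂ᴿ_{Dψ₀}` exists as an `L²`-class
with `𝖥ψ = P̂ᴿ_{Dψ₀}`. RH-FREE. [cite: Suzuki2025WeilHilbertSpace, Cor. 1.5 (TeX l.438–444) with Prop. 1.3 (TeX l.392–405); erratum E21] -/
theorem exists_mem_suzukiVcircR {ψ₀ : ℝ → ℂ} (hψ₀ : IsWeilTest ψ₀) :
    ∃ ψ ∈ suzukiVcircR, IsVcircRepR ψ₀ ψ := by
  have hP : MemLp (fun x : ℝ ↦ screwPhatR (suzukiD ψ₀) x) 2 volume :=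
    memLp_screwPhatR hψ₀.suzukiD
  have hG : MemLp (fun ξ : ℝ ↦ screwPhatR (suzukiD ψ₀) ((-(2 * Real.pi) * ξ : ℝ) : ℂ)) 2 volume :=
    ScrewLineRepairedCor15.memLp_two_comp_mul_left hP (neg_ne_zero.2 Real.two_pi_pos.ne')
  have hrep : IsVcircRepR ψ₀ (𝓕⁻ (hG.toLp _) : Lp ℂ 2 (volume : Measure ℝ)) := by
    unfold IsVcircRepR
    rw [FourierTransform.fourier_fourierInv_eq]
    exact hG.coeFn_toLp
  exact ⟨_, ⟨ψ₀, hψ₀, hrep⟩, hrep⟩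

/-- `0 ∈ V°(0)ᴿ` (generated by `ψ₀ = 0`). [cite: Suzuki2025WeilHilbertSpace, Cor. 1.5 (TeX l.438–444: V°(0) is a subspace of L²(ℝ)); erratum E21] -/
theorem zero_mem_suzukiVcircR : (0 : Lp ℂ 2 (volume : Measure ℝ)) ∈ suzukiVcircR := by
  refine ⟨0, ⟨contDiff_const, HasCompactSupport.zero⟩, ?_⟩
  unfold IsVcircRepR
  rw [FourierTransform.fourier_zero]
  have hD : suzukiD (0 : ℝ → ℂ) = 0 := by
    funext t; simp [suzukiD]
  have hP : ∀ z : ℂ, screwPhatR (0 : ℝ → ℂ) z = 0 := fun z ↦ by simp [screwPhatR]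
  filter_upwards [Lp.coeFn_zero ℂ 2 (volume : Measure ℝ)] with ξ hξ
  rw [hξ, hD, hP, Pi.zero_apply]

/-- **"Equation (1.9) is reformulated to the following simpler form"** (CJM p. 3, TeX l.436), repaired
and unconditional: condition (1.10)ᴿ on `V°(0)ᴿ` is EQUIVALENT to condition (1.9)ᴿ
`‖P̂ᴿ_{Dψ}‖² = π⟨ψ,ψ⟩_W` on `C_c^∞(ℝ)`. RH-FREE. [cite: Suzuki2025WeilHilbertSpace, p. 3 (TeX l.436) and proof of Cor. 1.5 §4.3 (TeX l.1352–1380); erratum E21] -/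
theorem Suzuki2025_eq110R_iff_eq19R :
    (∀ ψ ∈ suzukiVcircR, ∀ ψ₀ : ℝ → ℂ, IsWeilTest ψ₀ → IsVcircRepR ψ₀ ψ →
        ((2 * ‖ψ‖ ^ 2 : ℝ) : ℂ) = weilQuadratic ψ₀) ↔
      ∀ ψ₀ : ℝ → ℂ, IsWeilTest ψ₀ →
        ((∫ x : ℝ, ‖screwPhatR (suzukiD ψ₀) x‖ ^ 2 : ℝ) : ℂ) = Real.pi * weilQuadratic ψ₀ := by
  have hπ : (Real.pi : ℂ) ≠ 0 := Complex.ofReal_ne_zero.mpr Real.pi_ne_zero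
  have key : ∀ {ψ₀ : ℝ → ℂ} {ψ : Lp ℂ 2 (volume : Measure ℝ)}, IsVcircRepR ψ₀ ψ →
      (((2 * ‖ψ‖ ^ 2 : ℝ) : ℂ) = weilQuadratic ψ₀ ↔
        ((∫ x : ℝ, ‖screwPhatR (suzukiD ψ₀) x‖ ^ 2 : ℝ) : ℂ) = Real.pi * weilQuadratic ψ₀) := by
    intro ψ₀ ψ h
    have e : ((2 * ‖ψ‖ ^ 2 : ℝ) : ℂ) =
        ((∫ x : ℝ, ‖screwPhatR (suzukiD ψ₀) x‖ ^ 2 : ℝ) : ℂ) / (Real.pi : ℂ) := by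
      rw [norm_sq_of_isVcircRepR h, eq_div_iff hπ]
      push_cast
      field_simp
    rw [e, div_eq_iff hπ, mul_comm]
  constructor
  · intro h ψ₀ hψ₀
    obtain ⟨ψ, hψV, hrep⟩ := exists_mem_suzukiVcircR hψ₀
    exact (key hrep).1 (h ψ hψV ψ₀ hψ₀ hrep)
  · intro h ψ _ ψ₀ hψ₀ hrep
    exact (key hrep).2 (h ψ₀ hψ₀)

/-- **CJM Cor. 1.5ᴿ from Thm. 1.4ᴿ**: the printed derivation, PROVED as glue over the repaired
objects (no Prop 1.3 hypothesis). [cite: Suzuki2025WeilHilbertSpace, Cor. 1.5 p. 3, proof §4.3 (TeX l.1352–1380); erratum E21] -/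
theorem Suzuki2025_cor15R_of_thm14R (h14 : Suzuki2025_thm14R) : Suzuki2025_cor15R :=
  h14.trans Suzuki2025_eq110R_iff_eq19R.symm

/-- Conversely Thm. 1.4ᴿ from Cor. 1.5ᴿ. [cite: Suzuki2025WeilHilbertSpace, Cor. 1.5 p. 3 (TeX l.436: "Equation (1.9) is reformulated"); erratum E21] -/
theorem Suzuki2025_thm14R_of_cor15R (h15 : Suzuki2025_cor15R) : Suzuki2025_thm14R :=
  h15.trans Suzuki2025_eq110R_iff_eq19R

/-- The two repaired records are one statement in the kernel. [cite: Suzuki2025WeilHilbertSpace, Cor. 1.5 p. 3 (TeX l.436); erratum E21] -/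
theorem Suzuki2025_cor15R_iff_thm14R : Suzuki2025_cor15R ↔ Suzuki2025_thm14R :=
  ⟨Suzuki2025_thm14R_of_cor15R, Suzuki2025_cor15R_of_thm14R⟩

/-- Hence Cor. 1.5ᴿ also follows from Thm. 4.4ᴿ (through Thm. 1.4ᴿ, `Suzuki2025_thm14R_of_thm44R`).
[cite: Suzuki2025WeilHilbertSpace, §4.3 (TeX l.1340–1380: Thm 1.4 and Cor 1.5 deduced from Thm 4.4); erratum E21] -/
theorem Suzuki2025_cor15R_of_thm44R (h44 : Suzuki2025_thm44R) : Suzuki2025_cor15R :=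
  Suzuki2025_cor15R_of_thm14R (Suzuki2025_thm14R_of_thm44R h44)

/-- **The RH-free half of CJM Cor. 1.5ᴿ: (1.10)ᴿ on `V°(0)ᴿ` implies RH** ("by the same argument as
the second half of the proof of Theorem 4.4"): (1.10)ᴿ makes `⟨ψ₀,ψ₀⟩_W = 2‖𝖥⁻¹P̂ᴿ_{Dψ₀}‖² ≥ 0` for
every test function, i.e. Weil positivity, and RH follows from Weil's criterion
(`weil_criterion_holds`). RH-FREE and unconditional (Prop 1.3ᴿ is a theorem).
[cite: Suzuki2025WeilHilbertSpace, proof of Cor. 1.5 §4.3 (TeX l.1353–1354) and proof of Thm. 4.4 (TeX l.1303–1337); erratum E21] -/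
theorem Suzuki2025_cor15R_if
    (h : ∀ ψ ∈ suzukiVcircR, ∀ ψ₀ : ℝ → ℂ, IsWeilTest ψ₀ → IsVcircRepR ψ₀ ψ →
      ((2 * ‖ψ‖ ^ 2 : ℝ) : ℂ) = weilQuadratic ψ₀) :
    RiemannHypothesis :=
  Suzuki2025_thm14R_if (Suzuki2025_eq110R_iff_eq19R.1 h)

/-- So the repaired Cor 1.5 reduces to its RH-consequence half "RH ⟹ (1.10)ᴿ".
[cite: Suzuki2025WeilHilbertSpace, Cor. 1.5 (TeX l.438–451); erratum E21] -/
theorem Suzuki2025_cor15R_of_onlyIf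
    (h : RiemannHypothesis → ∀ ψ ∈ suzukiVcircR, ∀ ψ₀ : ℝ → ℂ, IsWeilTest ψ₀ → IsVcircRepR ψ₀ ψ →
      ((2 * ‖ψ‖ ^ 2 : ℝ) : ℂ) = weilQuadratic ψ₀) :
    Suzuki2025_cor15R :=
  ⟨h, Suzuki2025_cor15R_if⟩

/-! ## C. `‖·‖₀ᴿ` versus the `L²` norm on `V°(0)ᴿ`, and uniqueness of the generating test function -/

/-- **`(‖ψ₀‖₀ᴿ)² = 2‖ψ‖²_{L²}`** for `ψ = 𝖥⁻¹P̂ᴿ_{Dψ₀}`: the seminorm (3.9) of a test function is, up to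
`√2`, the `L²` norm of the element of `V°(0)ᴿ` it generates (Plancherel (5.8)). RH-FREE.
[cite: Suzuki2025WeilHilbertSpace, (3.9) (TeX l.1063–1064) with (5.8) (TeX l.1697); erratum E21] -/
theorem sq_screwNormZeroR_eq_of_isVcircRepR {ψ₀ : ℝ → ℂ} {ψ : Lp ℂ 2 (volume : Measure ℝ)}
    (h : IsVcircRepR ψ₀ ψ) : screwNormZeroR ψ₀ ^ 2 = 2 * ‖ψ‖ ^ 2 := by
  rw [screwNormZeroR, Real.sq_sqrt (div_nonneg (integral_nonneg fun _ ↦ by positivity)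
    Real.pi_pos.le), norm_sq_of_isVcircRepR h]
  field_simp

/-- **The generating test function of an element of `V°(0)ᴿ` is unique** — the repaired reading of
"`⟨ψ,ψ⟩_W` is defined and satisfies `⟨ψ,ψ⟩_W = ⟨ψ₀,ψ₀⟩_W`" (proof of Cor 1.5, TeX l.1366–1373): if
`𝖥ψ = P̂ᴿ_{Dψ₀} = P̂ᴿ_{Dψ₀'}` then `‖ψ₀ − ψ₀'‖₀ᴿ = 0`, hence `ψ₀ = ψ₀'` by Lemma 3.2ᴿ (iii). (For the
printed even extension this FAILS — two test functions differing by an even one generate the same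
class, `ScrewLineEvenExtension.screwNormZero_eq_zero_of_even` — which is erratum E21.) RH-FREE.
[cite: Suzuki2025WeilHilbertSpace, proof of Cor. 1.5 §4.3 (TeX l.1366–1373) with Lemma 3.2 (iii); erratum E21] -/
theorem IsVcircRepR.generator_unique {ψ₀ ψ₀' : ℝ → ℂ} (h₀ : IsWeilTest ψ₀) (h₀' : IsWeilTest ψ₀')
    {ψ : Lp ℂ 2 (volume : Measure ℝ)} (h : IsVcircRepR ψ₀ ψ) (h' : IsVcircRepR ψ₀' ψ) :
    ψ₀ = ψ₀' := by
  -- the difference `δ := ψ₀ − ψ₀'` is a test function with `Dδ = Dψ₀ + (−1)·Dψ₀'`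
  have hneg : IsWeilTest (fun t ↦ (-1 : ℂ) * ψ₀' t) := ⟨contDiff_const.mul h₀'.1, h₀'.2.mul_left⟩
  have hδ : IsWeilTest (ψ₀ + fun t ↦ (-1 : ℂ) * ψ₀' t) := ⟨h₀.1.add hneg.1, h₀.2.add hneg.2⟩
  have hsub : ψ₀ - ψ₀' = ψ₀ + fun t ↦ (-1 : ℂ) * ψ₀' t := by
    funext t; simp [sub_eq_add_neg]
  have hD : suzukiD (ψ₀ + fun t ↦ (-1 : ℂ) * ψ₀' t) =
      suzukiD ψ₀ + fun t ↦ (-1 : ℂ) * suzukiD ψ₀' t := by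
    funext t
    simp only [suzukiD, Pi.add_apply]
    rw [deriv_add (h₀.1.differentiable (by simp) t) (hneg.1.differentiable (by simp) t),
      deriv_const_mul_field']
    ring
  have hneg' : IsWeilTest (fun t ↦ (-1 : ℂ) * suzukiD ψ₀' t) :=
    ⟨contDiff_const.mul h₀'.suzukiD.1, h₀'.suzukiD.2.mul_left⟩
  have hP : ∀ x : ℝ, screwPhatR (suzukiD (ψ₀ + fun t ↦ (-1 : ℂ) * ψ₀' t)) x =
      screwPhatR (suzukiD ψ₀) x - screwPhatR (suzukiD ψ₀') x := by
    intro x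
    rw [hD, screwPhatR_add h₀.suzukiD hneg', screwPhatR_const_mul]
    ring
  -- `P̂ᴿ_{Dδ}(−2πξ) = 0` for a.e. `ξ`, so `∫ ‖P̂ᴿ_{Dδ}‖² = 0`
  have hae : ∀ᵐ ξ : ℝ, (fun x : ℝ ↦ ‖screwPhatR (suzukiD (ψ₀ + fun t ↦ (-1 : ℂ) * ψ₀' t)) x‖ ^ 2)
      (-(2 * Real.pi) * ξ) = 0 := by
    filter_upwards [h, h'] with ξ h1 h2
    show ‖screwPhatR (suzukiD (ψ₀ + fun t ↦ (-1 : ℂ) * ψ₀' t))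
      ((-(2 * Real.pi) * ξ : ℝ) : ℂ)‖ ^ 2 = 0
    rw [hP, ← h1, ← h2, sub_self, norm_zero, sq, mul_zero]
  have hint : ∫ x : ℝ, ‖screwPhatR (suzukiD (ψ₀ + fun t ↦ (-1 : ℂ) * ψ₀' t)) x‖ ^ 2 = 0 := by
    have h1 := ScrewLineRepairedCor15.integral_comp_neg_two_pi_mul
      (fun x : ℝ ↦ ‖screwPhatR (suzukiD (ψ₀ + fun t ↦ (-1 : ℂ) * ψ₀' t)) x‖ ^ 2)
    rw [integral_congr_ae hae, integral_zero] at h1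
    have h2π : (2 * Real.pi)⁻¹ ≠ 0 := inv_ne_zero Real.two_pi_pos.ne'
    exact (mul_eq_zero.1 h1.symm).resolve_left h2π
  have hnorm : screwNormZeroR (ψ₀ + fun t ↦ (-1 : ℂ) * ψ₀' t) = 0 := by
    rw [screwNormZeroR, hint, zero_div, Real.sqrt_zero]
  have h0 := Suzuki2025_lemma32R_iii _ hδ hnorm
  rw [← hsub] at h0
  exact sub_eq_zero.1 h0

/-- Consequently **`⟨ψ,ψ⟩_W` is well defined on `V°(0)ᴿ`**: all generating test functions of an element
have the same Weil quadratic form. RH-FREE. [cite: Suzuki2025WeilHilbertSpace, proof of Cor. 1.5 §4.3 (TeX l.1366–1373: "⟨ψ,ψ⟩_W is defined and satisfies ⟨ψ,ψ⟩_W = ⟨ψ₀,ψ₀⟩_W"); erratum E21] -/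
theorem weilQuadratic_generator_wellDefined {ψ₀ ψ₀' : ℝ → ℂ} (h₀ : IsWeilTest ψ₀)
    (h₀' : IsWeilTest ψ₀') {ψ : Lp ℂ 2 (volume : Measure ℝ)} (h : IsVcircRepR ψ₀ ψ)
    (h' : IsVcircRepR ψ₀' ψ) : weilQuadratic ψ₀ = weilQuadratic ψ₀' := by
  rw [IsVcircRepR.generator_unique h₀ h₀' h h']

end Literature.NumberTheory.LFunctions
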